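import Summits.KontsevichZagierPeriods.KontsevichZagierPeriods.Theorems.UnfoldedStokesStokesGenerationFibrewiseRungScalingSwaps

/-!
# `StokesGeneration` (stmt-KontsevichZagierPeriods-3586), line `fibrewise_stokes` — rung 12: coordinate permutations and
# reflections are absorbed by S2's economy

Crux `Summit.KontsevichZagierPeriods.KontsevichZagierPeriods.Theses.UnfoldedStokes.StokesGeneration`; residual stub S2
`stub_fibrewiseStokesGeneration` (`FibStokesDecomposable`, `Theorems/UnfoldedStokesDefs.lean`). For a `ℚ`-semialgebraic `h`,
continuous on the closed unit cube `[0,1]^N` with `ℚ`-semialgebraic continuous partial derivatives in the open fibres, and ANY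
permutation `σ` of the coordinates, `h − h ∘ σ` is fibrewise-Stokes decomposable (`fibStokesDecomposable_sub_comp_perm`):
on the doubled cube `[0,1]^{N+N}` every slot of the reading of `h` is moved onto a fresh coordinate by the scaling certificate
(`fibStokesDecomposable_moveReading`, two elements per move, `fibStokesDecomposable_reading_sub_fresh`), for the identity and
for `σ` alike, and both end at the same fresh reading. Likewise `h − h ∘ ρ_a` for the reflection `ρ_a : x_a ↦ 1 − x_a`
(`fibStokesDecomposable_sub_comp_reflect`). So Kontsevich–Zagier's change-of-variables rule (2) for the whole hyperoctahedral
group of the cube is DERIVABLE from the fibrewise Newton–Leibniz rule (3) — transcendence-free and value-free; in particular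
all antisymmetrisations `h(x,y) − h(y,x)` (e.g. exterior products `u(x)v(y) − u(y)v(x)`, the "swap relator" of the c5
frontier analysis) are decomposable.

References: M. Kontsevich, D. Zagier, *Periods* (2001), §1.2 rules (2), (3).
-/

noncomputable section

set_option linter.dupNamespace false

namespace Summit.KontsevichZagierPeriods.KontsevichZagierPeriods.Cruxes.StokesGeneration.FibrewiseStokes

open MeasureTheory Set
open Literature.NumberTheory.Transcendental
open Literature.NumberTheory.Transcendental.KZ
open Literature.ModelTheory.ExponentialFields (IsSemialgebraic)

/-- Updating the source of an injective reading `e` at the slot `e i` is updating the read point at `i`. [folklore] -/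
theorem comp_update_of_injective {N M : ℕ} {e : Fin N → Fin M} (he : Function.Injective e) (y : Fin M → ℝ)
    (i : Fin N) (s : ℝ) :
    (fun j => Function.update y (e i) s (e j)) = Function.update (fun j => y (e j)) i s := by
  ext j
  rcases eq_or_ne j i with rfl | hji
  · simp
  · rw [Function.update_of_ne (he.ne hji), Function.update_of_ne hji]

/-- Reading along an updated reading map `e[i ↦ b]` is reading along `e` and then overwriting slot `i` by `y b`.
[folklore] -/
theorem comp_update_reading {N M : ℕ} (e : Fin N → Fin M) (y : Fin M → ℝ) (i : Fin N) (b : Fin M) :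
    (fun j => y (Function.update e i b j)) = Function.update (fun j => y (e j)) i (y b) := by
  ext j
  rcases eq_or_ne j i with rfl | hji
  · simp
  · rw [Function.update_of_ne hji, Function.update_of_ne hji]

/-- A reading of a point of the closed unit cube `[0,1]^M` along any map `Fin N → Fin M` lies in `[0,1]^N`. [folklore] -/
theorem comp_reading_mem_cubePi {N M : ℕ} (e : Fin N → Fin M) {y : Fin M → ℝ}
    (hy : y ∈ Set.pi Set.univ (fun _ : Fin M => Set.Icc (0:ℝ) 1)) :
    (fun j => y (e j)) ∈ Set.pi Set.univ (fun _ : Fin N => Set.Icc (0:ℝ) 1) :=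
  Set.mem_univ_pi.mpr fun j => (Set.mem_univ_pi.mp hy) (e j)

/-- **Moving one slot of an injective reading onto an idle coordinate.** Let `h` be `ℚ`-semialgebraic and continuous on
`[0,1]^N` with `ℚ`-semialgebraic continuous partial derivatives `hp i` along every coordinate (in the open fibres). Read
`h` along an injective `e : Fin N → Fin M` on the big cube `[0,1]^M`, and let `b` be a coordinate of the big cube not
read by `e`. Then moving the slot `i` from `e i` to `b` changes the reading by a fibrewise-Stokes decomposable function
(`fibStokesDecomposable_moveCoord`; two elements, transcendence-free). [folklore] -/
theorem fibStokesDecomposable_moveReading {N M : ℕ} (h : (Fin N → ℝ) → ℝ) (hp : Fin N → (Fin N → ℝ) → ℝ)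
    (hh : IsSemialgebraicFunOn ℚ (Set.pi Set.univ (fun _ : Fin N => Set.Icc (0:ℝ) 1)) h)
    (hhc : ContinuousOn h (Set.pi Set.univ (fun _ : Fin N => Set.Icc (0:ℝ) 1)))
    (hps : ∀ i, IsSemialgebraicFunOn ℚ (Set.pi Set.univ (fun _ : Fin N => Set.Icc (0:ℝ) 1)) (hp i))
    (hpc : ∀ i, ContinuousOn (hp i) (Set.pi Set.univ (fun _ : Fin N => Set.Icc (0:ℝ) 1)))
    (hd : ∀ i, ∀ x ∈ Set.pi Set.univ (fun _ : Fin N => Set.Icc (0:ℝ) 1), x i ∈ Set.Ioo (0:ℝ) 1 →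
      HasDerivAt (fun s => h (Function.update x i s)) (hp i x) (x i))
    (e : Fin N → Fin M) (he : Function.Injective e) (i : Fin N) (b : Fin M) (heb : ∀ j, e j ≠ b) :
    FibStokesDecomposable M (fun y => h (fun j => y (e j)) - h (fun j => y (Function.update e i b j))) := by
  have hCM : IsSemialgebraic ℚ (Set.pi Set.univ (fun _ : Fin M => Set.Icc (0:ℝ) 1)) := by
    rw [← cube_eq_pi]; exact isSemialgebraic_cube
  -- the reading of a semialgebraic / continuous function is semialgebraic / continuous on the big cube
  have hread : ∀ {F : (Fin N → ℝ) → ℝ}, IsSemialgebraicFunOn ℚ (Set.pi Set.univ (fun _ : Fin N => Set.Icc (0:ℝ) 1)) F →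
      IsSemialgebraicFunOn ℚ (Set.pi Set.univ (fun _ : Fin M => Set.Icc (0:ℝ) 1)) (fun y => F (fun j => y (e j))) :=
    fun hF => (isSemialgebraicFunOn_comp_coord hF e).mono (fun y hy => comp_reading_mem_cubePi e hy) hCM
  have hπc : Continuous fun y : Fin M → ℝ => fun j => y (e j) := continuous_pi fun j => continuous_apply (e j)
  have hreadc : ∀ {F : (Fin N → ℝ) → ℝ}, ContinuousOn F (Set.pi Set.univ (fun _ : Fin N => Set.Icc (0:ℝ) 1)) →
      ContinuousOn (fun y => F (fun j => y (e j))) (Set.pi Set.univ (fun _ : Fin M => Set.Icc (0:ℝ) 1)) :=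
    fun hF => hF.comp hπc.continuousOn fun y hy => comp_reading_mem_cubePi e hy
  have key := fibStokesDecomposable_moveCoord (e i) b (heb i) (fun y => h (fun j => y (e j)))
    (fun y => hp i (fun j => y (e j))) (hread hh) (hread (hps i)) (hreadc hhc) (hreadc (hpc i))
    (fun y s => by simp only [Function.update_of_ne (heb _)])
    (fun y s => by simp only [Function.update_of_ne (heb _)])
    (fun y hy hyi => by
      have := hd i _ (comp_reading_mem_cubePi e hy) (by simpa using hyi)
      simpa only [comp_update_of_injective he] using this)
  refine fibStokesDecomposable_congr_off_null M _ _ ∅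
    Literature.ModelTheory.ExponentialFields.isSemialgebraic_empty measure_empty (fun y _ _ => ?_) key
  simp only [comp_update_of_injective he, comp_update_reading]

/-- **Every reading moves to the fresh half.** For `h` as in `fibStokesDecomposable_moveReading` and a permutation `τ`
of `Fin N`, on the doubled cube `[0,1]^{N+N}` the difference between the reading of `h` along `castAdd ∘ τ` (original
half, permuted) and along `natAdd` (fresh half, unpermuted) is fibrewise-Stokes decomposable: move the slots one by one
(`N` steps of two elements each). [folklore] -/
theorem fibStokesDecomposable_reading_sub_fresh {N : ℕ} (h : (Fin N → ℝ) → ℝ) (hp : Fin N → (Fin N → ℝ) → ℝ)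
    (hh : IsSemialgebraicFunOn ℚ (Set.pi Set.univ (fun _ : Fin N => Set.Icc (0:ℝ) 1)) h)
    (hhc : ContinuousOn h (Set.pi Set.univ (fun _ : Fin N => Set.Icc (0:ℝ) 1)))
    (hps : ∀ i, IsSemialgebraicFunOn ℚ (Set.pi Set.univ (fun _ : Fin N => Set.Icc (0:ℝ) 1)) (hp i))
    (hpc : ∀ i, ContinuousOn (hp i) (Set.pi Set.univ (fun _ : Fin N => Set.Icc (0:ℝ) 1)))
    (hd : ∀ i, ∀ x ∈ Set.pi Set.univ (fun _ : Fin N => Set.Icc (0:ℝ) 1), x i ∈ Set.Ioo (0:ℝ) 1 →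
      HasDerivAt (fun s => h (Function.update x i s)) (hp i x) (x i))
    (τ : Equiv.Perm (Fin N)) :
    FibStokesDecomposable (N + N)
      (fun y => h (fun j => y (Fin.castAdd N (τ j))) - h (fun j => y (Fin.natAdd N j))) := by
  classical
  -- the interpolating readings `E k`: the first `k` slots already fresh
  obtain ⟨E, hE⟩ : ∃ E : ℕ → Fin N → Fin (N + N), E = fun (k : ℕ) (j : Fin N) =>
      if (j : ℕ) < k then Fin.natAdd N j else Fin.castAdd N (τ j) := ⟨_, rfl⟩
  have hE0 : E 0 = fun j => Fin.castAdd N (τ j) := by rw [hE]; ext j; simp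
  have hEN : E N = fun j => Fin.natAdd N j := by rw [hE]; ext j; simp [j.isLt]
  have hEinj : ∀ k, Function.Injective (E k) := by
    intro k j₁ j₂ hj
    rw [hE] at hj
    simp only at hj
    split_ifs at hj with h₁ h₂ h₂
    · exact Fin.ext (by simpa [Fin.ext_iff] using hj)
    · exact absurd (congrArg Fin.val hj) (by simp [Fin.val_castAdd]; omega)
    · exact absurd (congrArg Fin.val hj) (by simp [Fin.val_castAdd]; omega)
    · exact τ.injective (Fin.ext (by simpa [Fin.ext_iff] using hj))
  have hEfresh : ∀ k (hk : k < N) (j : Fin N), E k j ≠ Fin.natAdd N ⟨k, hk⟩ := by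
    intro k hk j hj
    rw [hE] at hj
    simp only at hj
    split_ifs at hj with h₁
    · exact absurd (congrArg Fin.val hj) (by simp; omega)
    · exact absurd (congrArg Fin.val hj) (by simp [Fin.val_castAdd]; omega)
  have hEsucc : ∀ k (hk : k < N), E (k + 1) = Function.update (E k) ⟨k, hk⟩ (Fin.natAdd N ⟨k, hk⟩) := by
    intro k hk
    ext j
    rcases eq_or_ne j ⟨k, hk⟩ with rfl | hj
    · rw [hE]; simp
    · rw [Function.update_of_ne hj, hE]
      have hjk : (j : ℕ) ≠ k := fun h' => hj (Fin.ext h')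
      simp only
      by_cases hlt : (j : ℕ) < k
      · simp [hlt, show (j : ℕ) < k + 1 by omega]
      · simp [hlt, show ¬ ((j : ℕ) < k + 1) by omega]
  -- telescoping induction
  have htel : ∀ k, k ≤ N → FibStokesDecomposable (N + N)
      (fun y => h (fun j => y (E 0 j)) - h (fun j => y (E k j))) := by
    intro k
    induction k with
    | zero =>
      intro _
      simpa using fibStokesDecomposable_zero (N + N)
    | succ k ih =>
      intro hk
      have hk' : k < N := Nat.lt_of_succ_le hk
      have step := fibStokesDecomposable_moveReading h hp hh hhc hps hpc hd (E k) (hEinj k) ⟨k, hk'⟩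
        (Fin.natAdd N ⟨k, hk'⟩) (hEfresh k hk')
      rw [← hEsucc k hk'] at step
      refine fibStokesDecomposable_congr_off_null (N + N) _ _ ∅
        Literature.ModelTheory.ExponentialFields.isSemialgebraic_empty measure_empty (fun y _ _ => ?_)
        (fibStokesDecomposable_add (N + N) _ _ (ih hk'.le) step)
      ring
  have := htel N le_rfl
  rw [hE0, hEN] at this
  exact this

/-- **S2's economy absorbs coordinate permutations (lead c5).** Let `h` be `ℚ`-semialgebraic and continuous on the
closed unit cube `[0,1]^N`, with `ℚ`-semialgebraic continuous partial derivatives along every coordinate in the open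
fibres. Then for every permutation `σ` of the coordinates, `h − h ∘ σ` is fibrewise-Stokes decomposable on `[0,1]^N`:
Kontsevich–Zagier's change-of-variables rule (2) for coordinate permutations of a cube is DERIVABLE from the fibrewise
Newton–Leibniz rule (3) on the doubled cube `[0,1]^{2N}` (`4N` elements), with no transcendence input and no hypothesis
on the value. In particular exterior products `u(x)v(y) − u(y)v(x)` and all antisymmetrisations are decomposable.
[cite: KontsevichZagier2001, §1.2 rules (2), (3)] -/
theorem fibStokesDecomposable_sub_comp_perm {N : ℕ} (h : (Fin N → ℝ) → ℝ) (hp : Fin N → (Fin N → ℝ) → ℝ)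
    (hh : IsSemialgebraicFunOn ℚ (Set.pi Set.univ (fun _ : Fin N => Set.Icc (0:ℝ) 1)) h)
    (hhc : ContinuousOn h (Set.pi Set.univ (fun _ : Fin N => Set.Icc (0:ℝ) 1)))
    (hps : ∀ i, IsSemialgebraicFunOn ℚ (Set.pi Set.univ (fun _ : Fin N => Set.Icc (0:ℝ) 1)) (hp i))
    (hpc : ∀ i, ContinuousOn (hp i) (Set.pi Set.univ (fun _ : Fin N => Set.Icc (0:ℝ) 1)))
    (hd : ∀ i, ∀ x ∈ Set.pi Set.univ (fun _ : Fin N => Set.Icc (0:ℝ) 1), x i ∈ Set.Ioo (0:ℝ) 1 →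
      HasDerivAt (fun s => h (Function.update x i s)) (hp i x) (x i))
    (σ : Equiv.Perm (Fin N)) :
    FibStokesDecomposable N (fun x => h x - h (fun l => x (σ l))) := by
  have h1 := fibStokesDecomposable_reading_sub_fresh h hp hh hhc hps hpc hd (Equiv.refl _)
  have hσ := fibStokesDecomposable_reading_sub_fresh h hp hh hhc hps hpc hd σ
  have hdiff := fibStokesDecomposable_sub (N + N) _ _ h1 hσ
  have hle : N ≤ N + N := Nat.le_add_right N N
  refine fibStokesDecomposable_unpad hle _ (fibStokesDecomposable_congr_off_null (N + N) _ _ ∅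
    Literature.ModelTheory.ExponentialFields.isSemialgebraic_empty measure_empty (fun y _ _ => ?_) hdiff)
  simp only [Equiv.refl_apply]
  show _ = h (fun l => y (Fin.castLE hle l)) - h (fun l => y (Fin.castLE hle (σ l)))
  have e1 : (fun j => y (Fin.castAdd N j)) = fun l => y (Fin.castLE hle l) := rfl
  have e2 : (fun j => y (Fin.castAdd N (σ j))) = fun l => y (Fin.castLE hle (σ l)) := rfl
  rw [e1, e2]
  ring

/-! ## Reflections -/

/-- **S2's economy absorbs coordinate reflections (lead c5).** Let `h` be `ℚ`-semialgebraic and continuous on `[0,1]^N` and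
`C¹` along the coordinate `a` with a `ℚ`-semialgebraic continuous fibre derivative `hₐ` (open fibres). Then
`h(x) − h(x[a ↦ 1 − x_a])` is fibrewise-Stokes decomposable on `[0,1]^N`: on the cube `[0,1]^{N+1}` with one idle coordinate
`b`, `h(x) − h(x[a ↦ 1 − x_b])` (`fibStokesDecomposable_moveCoordRefl`) and `h(x[a ↦ 1 − x_a]) − h(x[a ↦ 1 − x_b])`
(`fibStokesDecomposable_moveCoord` for the reflected function) are decomposable; subtract and un-pad. Four elements,
transcendence-free, value-free. With `fibStokesDecomposable_sub_comp_perm` the whole hyperoctahedral group of the cube is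
absorbed. [cite: KontsevichZagier2001, §1.2 rules (2), (3)] -/
theorem fibStokesDecomposable_sub_comp_reflect {N : ℕ} (a : Fin N) (h hₐ : (Fin N → ℝ) → ℝ)
    (hh : IsSemialgebraicFunOn ℚ (Set.pi Set.univ (fun _ : Fin N => Set.Icc (0:ℝ) 1)) h)
    (hhₐ : IsSemialgebraicFunOn ℚ (Set.pi Set.univ (fun _ : Fin N => Set.Icc (0:ℝ) 1)) hₐ)
    (hhc : ContinuousOn h (Set.pi Set.univ (fun _ : Fin N => Set.Icc (0:ℝ) 1)))
    (hhₐc : ContinuousOn hₐ (Set.pi Set.univ (fun _ : Fin N => Set.Icc (0:ℝ) 1)))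
    (hd : ∀ x ∈ Set.pi Set.univ (fun _ : Fin N => Set.Icc (0:ℝ) 1), x a ∈ Set.Ioo (0:ℝ) 1 →
      HasDerivAt (fun s => h (Function.update x a s)) (hₐ x) (x a)) :
    FibStokesDecomposable N (fun x => h x - h (Function.update x a (1 - x a))) := by
  set C : Set (Fin N → ℝ) := Set.pi Set.univ (fun _ : Fin N => Set.Icc (0:ℝ) 1) with hC
  have hCsa : IsSemialgebraic ℚ C := by rw [hC, ← cube_eq_pi]; exact isSemialgebraic_cube
  have hCM : IsSemialgebraic ℚ (Set.pi Set.univ (fun _ : Fin (N + 1) => Set.Icc (0:ℝ) 1)) := by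
    rw [← cube_eq_pi]; exact isSemialgebraic_cube
  have hmem : ∀ x ∈ C, ∀ i, x i ∈ Set.Icc (0:ℝ) 1 := fun x hx i => (Set.mem_univ_pi.mp hx) i
  have hrefl : ∀ u ∈ Set.Icc (0:ℝ) 1, 1 - u ∈ Set.Icc (0:ℝ) 1 := fun u hu => ⟨by linarith [hu.2], by linarith [hu.1]⟩
  have hreflo : ∀ u ∈ Set.Ioo (0:ℝ) 1, 1 - u ∈ Set.Ioo (0:ℝ) 1 := fun u hu => ⟨by linarith [hu.2], by linarith [hu.1]⟩
  -- the fibre derivative along `a` at an arbitrary interior height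
  have hH : ∀ x ∈ C, ∀ u₀ ∈ Set.Ioo (0:ℝ) 1,
      HasDerivAt (fun u => h (Function.update x a u)) (hₐ (Function.update x a u₀)) u₀ := by
    intro x hx u₀ hu₀
    have hx' : Function.update x a u₀ ∈ C := update_mem_cubePi hx a (Set.Ioo_subset_Icc_self hu₀)
    have := hd _ hx' (by simpa using hu₀)
    simpa [Function.update_idem] using this
  -- the reflection self-map `R` of the cube in the coordinate `a`
  obtain ⟨R, hR⟩ : ∃ R : (Fin N → ℝ) → (Fin N → ℝ), R = fun x => Function.update x a (1 - x a) := ⟨_, rfl⟩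
  have hRsa : IsSemialgebraicMapOn ℚ C R := by
    refine IsSemialgebraicMapOn.of_forall hCsa fun j => ?_
    rcases eq_or_ne j a with rfl | hja
    · exact ((isSemialgebraicFunOn_const_of_isAlgebraic hCsa isAlgebraic_one).fun_sub
        (isSemialgebraicFunOn_apply hCsa j)).congr fun x _ => by simp [hR]
    · exact (isSemialgebraicFunOn_apply hCsa j).congr fun x _ => by simp [hR, Function.update_of_ne hja]
  have hRmaps : Set.MapsTo R C C := fun x hx => by rw [hR]; exact update_mem_cubePi hx a (hrefl _ (hmem x hx a))
  have hRc : Continuous R := by rw [hR]; exact continuous_id.update a (continuous_const.sub (continuous_apply a))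
  have hh' : IsSemialgebraicFunOn ℚ C (fun x => h (R x)) := IsSemialgebraicFunOn.comp_isSemialgebraicMapOn_holds hh hRsa hRmaps
  have hhₐ' : IsSemialgebraicFunOn ℚ C (fun x => -hₐ (R x)) :=
    (IsSemialgebraicFunOn.comp_isSemialgebraicMapOn_holds hhₐ hRsa hRmaps).fun_neg
  have hhc' : ContinuousOn (fun x => h (R x)) C := hhc.comp hRc.continuousOn hRmaps
  have hhₐc' : ContinuousOn (fun x => -hₐ (R x)) C := (hhₐc.comp hRc.continuousOn hRmaps).neg
  -- readings along `castSucc` on the cube `[0,1]^{N+1}`; the idle coordinate is `last`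
  have hne : ∀ j : Fin N, Fin.castSucc j ≠ Fin.last N := fun j => (Fin.castSucc_lt_last j).ne
  have hread : ∀ {F : (Fin N → ℝ) → ℝ}, IsSemialgebraicFunOn ℚ C F →
      IsSemialgebraicFunOn ℚ (Set.pi Set.univ (fun _ : Fin (N + 1) => Set.Icc (0:ℝ) 1))
        (fun y => F (fun j => y (Fin.castSucc j))) :=
    fun hF => (isSemialgebraicFunOn_comp_coord hF Fin.castSucc).mono (fun y hy => comp_reading_mem_cubePi _ hy) hCM
  have hπc : Continuous fun y : Fin (N + 1) → ℝ => fun j => y (Fin.castSucc j) :=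
    continuous_pi fun j => continuous_apply (Fin.castSucc j)
  have hreadc : ∀ {F : (Fin N → ℝ) → ℝ}, ContinuousOn F C →
      ContinuousOn (fun y => F (fun j => y (Fin.castSucc j))) (Set.pi Set.univ (fun _ : Fin (N + 1) => Set.Icc (0:ℝ) 1)) :=
    fun hF => hF.comp hπc.continuousOn fun y hy => comp_reading_mem_cubePi _ hy
  have hcu : ∀ (y : Fin (N + 1) → ℝ) (t : ℝ),
      (fun j => Function.update y (Fin.castSucc a) t (Fin.castSucc j)) =
        Function.update (fun j => y (Fin.castSucc j)) a t :=
    fun y t => comp_update_of_injective (Fin.castSucc_injective N) y a t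
  -- (i) `h(x) − h(x[a ↦ 1 − x_b])`
  have h1 := fibStokesDecomposable_moveCoordRefl (Fin.castSucc a) (Fin.last N) (hne a)
    (fun y => h (fun j => y (Fin.castSucc j))) (fun y => hₐ (fun j => y (Fin.castSucc j)))
    (hread hh) (hread hhₐ) (hreadc hhc) (hreadc hhₐc)
    (fun y s => by simp only [Function.update_of_ne (hne _)])
    (fun y s => by simp only [Function.update_of_ne (hne _)])
    (fun y hy hya => by
      have := hd _ (comp_reading_mem_cubePi _ hy) (by simpa using hya)
      simpa only [hcu] using this)
  -- (ii) `h(x[a ↦ 1 − x_a]) − h(x[a ↦ 1 − x_b])`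
  have h2 := fibStokesDecomposable_moveCoord (Fin.castSucc a) (Fin.last N) (hne a)
    (fun y => h (R (fun j => y (Fin.castSucc j)))) (fun y => -hₐ (R (fun j => y (Fin.castSucc j))))
    (hread hh') (hread hhₐ') (hreadc hhc') (hreadc hhₐc')
    (fun y s => by simp only [Function.update_of_ne (hne _)])
    (fun y s => by simp only [Function.update_of_ne (hne _)])
    (fun y hy hya => by
      have hyC : (fun j => y (Fin.castSucc j)) ∈ C := comp_reading_mem_cubePi _ hy
      have hyaI : y (Fin.castSucc a) ∈ Set.Ioo (0:ℝ) 1 := by simpa using hya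
      have hfun : (fun s => h (R (fun j => Function.update y (Fin.castSucc a) s (Fin.castSucc j)))) =
          fun s => h (Function.update (fun j => y (Fin.castSucc j)) a (1 - s)) := by
        funext s; rw [hcu, hR]; simp [Function.update_idem]
      rw [hfun]
      have := (hH _ hyC _ (hreflo _ hyaI)).comp (y (Fin.castSucc a))
        ((hasDerivAt_id' (y (Fin.castSucc a))).const_sub 1)
      refine this.congr_deriv ?_
      rw [hR]
      simp)
  have hdiff := fibStokesDecomposable_sub (N + 1) _ _ h1 h2
  have hle : N ≤ N + 1 := N.le_succ
  refine fibStokesDecomposable_unpad hle _ (fibStokesDecomposable_congr_off_null (N + 1) _ _ ∅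
    Literature.ModelTheory.ExponentialFields.isSemialgebraic_empty measure_empty (fun y _ _ => ?_) hdiff)
  have e1 : (fun j => y (Fin.castSucc j)) = fun l => y (Fin.castLE hle l) := rfl
  have e2 : y (Fin.castSucc a) = y (Fin.castLE hle a) := rfl
  simp only [hcu]
  rw [hR]
  simp only [Function.update_idem, Function.update_self, e1, e2]
  ring

end Summit.KontsevichZagierPeriods.KontsevichZagierPeriods.Cruxes.StokesGeneration.FibrewiseStokes

end
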